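import Summits.CriticalPhenomena.CardyFormulaZ2.Theorems.CardyComplexConeEdgePrecompactPassageAgree

/-!
# Forward response stability from its uniform single-datum form (and the road map for it)
(line `qkz-strip-boundary-arm` of crux `CardyComplexCone.EdgePrecompact`, stmt-CriticalPhenomena-11387)

Second (and last purely logical) reduction of the registered stub `stub_responseStability` — the
residual probabilistic input of shift-coupling locality (chain: `stub_responseStability` ⟹
`hullStability_of_responseStability` ⟹ `shiftCouplingLocality_of_hullStability` ⟹ X2). After
`responseStability_of_forwardResponseStability` (`…EdgePrecompactResponseStabilityReduction.lean`:
the backward clause is the forward clause at `(v - w, -w, ω - w)`), the forward statement still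
carries the crux's family bookkeeping (`Λ : ℝ → DiscreteDobrushin`, `(Λ δ).Ω = D`, `(Λ δ).δ = δ`,
eventual admissibility, `∀ᶠ δ`, an unused face `f`). The family enters only through the single datum
`Λ δ`, so the forward statement follows from its UNIFORM SINGLE-DATUM form (the hypothesis below,
"UFRS"): for `D`, a compact `K` with `cthickening (2ρ) K ⊆ D` and `ε > 0` there are `η, δ₀ > 0` such
that for EVERY `ℤ²`-admissible datum `E` with `E.Ω = D.carrier` and mesh `E.δ < δ₀`, every site `v`
with `E.δ • v ∈ K` and every lattice shift `w` with `‖E.δ • w‖ < η`, the event "some admissible pair of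
corners (the two start corners, or a common exit corner of `B(E.δ v, ρ)`) has a stretch of the
`E`-orbit re-entering the ball through inner faces which the `shiftData E w`-orbit does not match
(same corner, inner faces, same turning sum)" has `P_{1/2}`-probability `≤ ε`. Registered sub-goal:
`forwardResponseStability_of_uniformForwardResponseStability : UFRS → FRS` (FRS = the hypothesis of
`responseStability_of_forwardResponseStability`; the composite `UFRS → stub_responseStability's statement`,
registered as `responseStability_of_uniformForwardResponseStability`, is the one-line composition of the
two, kept in a separate file so that this one does not wait for the build of the former). UFRS is the
statement to attack with RSW/arm technology; nothing logical is left to strip (the inner-face clauses are genuine: the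
orbit of an interior exit corner leaves the inner faces exactly at the exploration's exit corner, so
they say "before the exploration ends").

## Road map for UFRS (worker W10's analysis, not formalised; for the next prover)

Notation: `E₀ = E`, `E₁ = shiftData E w` (the EXACT `w`-translate: domain, `zdBoundary`, arcs, start
corner `a₁ = a₀ + w`, by `isStartCorner_shiftData_iff` and `…MedialExplorationShiftData`), `βᵢ =
Eᵢ.bcBondConfig ω`, ball `B = B(δv, ρ)` at distance `≥ ρ` from `∂D`, collar `N = {dist(·, ∂D) < 2η}`.
1. AGREEMENT OFF THE COLLAR (done: `collarAgreement`, `no_discrepancy_of_agree` in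
   `Theorems/CardyComplexConeEdgePrecompactCollarAgreement.lean`). For `E.δ < δ₀(D, η)` (bulk theorem
   `JordanDomain.exists_forall_mem_meshDomain_and_reachable` on the compact `{infDist(·, Dᶜ) ≥ η}`) every
   lattice edge at a `3η`-deep site has its `ω`-status in `β₀` and in `β₁` and every face there is inner
   for both: the two successor maps `nextCorner βᵢ` coincide off the `3η`-collar, and so do `turnOf βᵢ`.
2. STRUCTURE OF A FAILURE (deterministic; done abstractly in
   `Theorems/CardyComplexConeEdgePrecompactResponseLocalisation.lean`, `responseLocalisation`): a forward
   failure sits at the LAST SYNCHRONISED corner `e*` of the `β₀`-stretch (last corner reached by the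
   `β₁`-orbit through an inner, ball-avoiding stretch with the same turning sum; for the start pair
   possibly none: INITIAL discrepancy), followed by a FACE discrepancy (same step, new face inner for
   `E₀` and not for `E₁`: by `orbit_exit_or_stuck` there, the common orbit crosses the exit edge `e_b`
   of `E₁` at its `A`-end) or a SPLIT discrepancy (the target edge of `e*` has different status; every
   inner ball-avoiding return of the `β₁`-orbit of `e*` to the rest of the `β₀`-stretch carries a
   turning mismatch — (A) no timely return: a SWITCH of the collar re-connection; (B) a slipped return).
   By item 1, `e*` reads a collar edge or face: the failure is localised at a collar box `Q ∋ e*`, and the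
   `β₀`-stretch provides two far-reaching whiskers at `e*` (from the ball, back to the ball) along which
   `β₁` is synchronised.
3. COST OF (A) (arms, size L; not formalised). Let `R₀` be the rest of the `β₀`-stretch after `e*`
   (to the ball) and `R₁` the `β₁`-orbit of `e*` up to its first entry into the ball or its exit from the
   inner faces (it cannot cycle idly: the cycle through an exit corner re-enters the ball, the cycle
   through the start corner leaves the inner faces). In case (A) `R₀` and `R₁` are dart-disjoint (a
   common corner would be a return), long (from the collar box `Q ∋ e*` to the ball, or to the marked
   point of `E₁`), and leave the medial vertex `cTgt e*` by its two OPPOSITE out-darts; medial strands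
   never cross, not even across the two configurations (the two in-darts at a medial vertex are
   opposite). In the annulus `A(y_Q; 3η, ρ/2)` they bound two sectors; `R₀` carries an open arm of `β₀`
   on its left and a dual arm of `β₀` on its right, `R₁` likewise for `β₁` (`exists_left_chain` /
   `exists_right_chain`, `MedialExplorationChains`), so that reading around `Q` one sees dual, open,
   dual, open — FOUR alternating arms, equal colours in different sectors, arms of `ω` at `3η`-deep
   edges and riding the frozen arcs elsewhere: the arms of a Dobrushin boundary arm event. The frozen
   boundary swallows at most one: the boundary THREE-ARM event from scale `3η` to `ρ/2` at `Q`
   (`zdDomArmEvent` with `H` = the discrete domain; flat model and bound `Z2HalfPlane.threeArm`,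
   `Z2HalfPlane.real_threeArm_le`, exponent `1 + α`), degenerating near the marked points `a_δ, b_δ`
   (where wired and dual-wired arcs switch, one more arm is free) to the boundary TWO-ARM event
   (`Z2HalfPlane.real_twoArm_le`, exponent `1`). The INITIAL discrepancy (start pair) is the re-rooting
   at `a_δ` (`Cruxes/EdgePrecompact/ShiftCouplingWindingOffsetCex.md`): two-arm event at `a_δ`.
4. COST OF (B) and of FACE. In case (B) the `β₀`-run and the first-returning `β₁`-run lead from `e*`
   to the return corner `s` (whose source edge, generically, again has different status: `s` is in the
   collar too), are dart-disjoint, leave the medial vertex `cTgt e*` by its two opposite out-darts, enter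
   `cSrc s` by its two opposite in-darts, and never cross: they close up to a cusp-free non-crossing
   closed polygon `J` whose turning `±2π` (Umlaufsatz for the perturbed polygon, cf.
   `MedialCycleTurning.lean`; the oriented-trail version `MedialTrailUmlaufsatz.inv_cornerOrbit` does not
   apply verbatim since one run is reversed) equals the mismatch up to the two local right angles at
   `cTgt e*` and `cSrc s`; in every sign pattern a nonzero mismatch puts the incoming whisker or the
   continuation after `s` — both of which end in the ball — inside `J`, so `J` reaches the ball: again
   `≥ 3` long pairwise dart-disjoint strands at `Q ∋ e*` (or a double visit of `Q` by the `β₀`-stretch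
   with two long complementary arcs), priced as in item 3. The runs are NOT confined to the collar (after
   the split the `β₁`-orbit may ride bulk strands of other loops). FACE is the common orbit crossing the
   exit edge `e_b` of `E₁` from inside `E₀` (`orbit_exit_or_stuck`): a far-reaching `β₀`-path through
   the marked point `b_δ + δw` — the two-arm event at `b_δ`, or a cluster of an `O(η)`-short arc reaching
   distance `ρ` (one-arm bound). Arcs are arbitrary per datum: all bounds must be uniform in the
   positions of `a_δ, b_δ` — they are, being per-box.
5. SUMMATION. `P ≤ Σ_Q P(three arms at Q) + P(two arms at the boxes of a_δ, b_δ) + remainders`, the sum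
   over the `η`-boxes `Q` meeting `∂D`. With `N(η)` such boxes, `N(η) · C (η/ρ)^{1+α} → 0` needs
   `N(η) = o(η^{-(1+α)})`: fine for rectifiable `∂D` (`N(η) ≤ C · length / η`) or upper box dimension
   `< 1 + α`; NOT available for general Jordan curves (dimension up to `2`, even positive area). The
   flat bounds must moreover be transferred to `D ∩` annuli: immediate by monotonicity in the domain
   (`zdDomArmEvent_mono_dom`) where `D` lies in a LATTICE half-plane near `Q` (axis-parallel convex
   polygons), a slanted-half-plane version of `real_threeArm_le` / `real_twoArm_le` uniform in the
   slope for convex / C¹ domains, an intrinsic chord-arc version beyond.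
6. VERDICT ON ARBITRARY JORDAN `D`. UFRS (hence `stub_responseStability`) is very plausibly TRUE for
   every Jordan domain: three far-reaching arms do not enter fjords (screening), pivotal collar boxes
   are boundary-exposed, and in the conformally invariant caricature `Σ_Q P(Q pivotal) ≍ Σ_Q ω_B(Q)²
   ≤ sup_Q ω_B(Q) → 0` uniformly in the roughness (`ω_B` = harmonic measure seen from `B`, Beurling).
   But the collar UNION BOUND of item 5 cannot prove it when `N(η) ≫ η^{-(1+α)}`, and a screening lemma
   for percolation arms in rough domains is not in print. Recommended order: items 2–3 in full
   generality (they do not see `∂D`'s regularity); item 5 first for axis-parallel convex polygons /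
   rectifiable locally flat boundaries as a SEPARATE registered statement `… → UFRS restricted to such
   D`; general `D` waits for screening. No extra hypothesis on `D` should be written into
   `stub_responseStability` itself (the crux quantifies over all Dobrushin domains).

References: S. Smirnov, C. R. Acad. Sci. Paris 333 (2001), §2; G. F. Lawler, O. Schramm, W. Werner,
Electron. J. Probab. 7 (2002), Appendix A (half-plane two- and three-arm bounds); P. Nolin, Electron. J.
Probab. 13 (2008), §4 (arm events, universal exponents); C. Garban, G. Pete, O. Schramm, J. Amer. Math.
Soc. 26 (2013), §5 (interfaces started nearby merge); G. Grimmett, *Percolation* (1999), §11.2.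
-/

namespace Summit.CriticalPhenomena.CardyFormulaZ2.Cruxes.EdgePrecompact.QkzStripBoundaryArm

open MeasureTheory Filter Set Metric
open scoped Topology BigOperators Pointwise
open Literature.Probability.LatticeModels Literature.Probability.Percolation
open Literature.Probability.RandomPlanarGeometry (DobrushinDomain)
open Summit.CriticalPhenomena.CardyFormulaZ2.Theses.CardyComplexCone

noncomputable section

/-- **Forward response stability from its uniform single-datum form.** HYPOTHESIS (UFRS, inline):
for every Dobrushin domain `D`, compact `K ⊆ D`, radius `ρ > 0` with `cthickening (2ρ) K ⊆ D` and
`ε > 0` there are `η > 0` and `δ₀ > 0` such that for every `ℤ²`-admissible datum `E` with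
`E.Ω = D.carrier` and `E.δ < δ₀`, every `v` with `E.δ v ∈ K` and every `w` with `‖E.δ w‖ < η`, the
forward-response failure event at the ball `B(E.δ v, ρ)` has `P_{1/2}`-probability `≤ ε`. CONCLUSION:
forward response stability along every discretisation family (the hypothesis of
`responseStability_of_forwardResponseStability`, verbatim). Proof: specialise to `E = Λ δ` on the
eventuality where `Λ δ` is admissible and `δ < δ₀`, and rewrite `(Λ δ).δ = δ`. -/
theorem forwardResponseStability_of_uniformForwardResponseStability : (∀ (D : DobrushinDomain) (K : Set ℂ), IsCompact K → K ⊆ D.carrier → ∀ ρ > (0:ℝ), cthickening (2 * ρ) K ⊆ D.carrier → ∀ ε > (0:ℝ), ∃ η > (0:ℝ), ∃ δ₀ > (0:ℝ), ∀ E : DiscreteDobrushin, E.Ω = D.carrier → E.IsZdAdmissible → E.δ < δ₀ → ∀ v w : Site 2, meshPoint E.δ v ∈ K → ‖meshPoint E.δ w‖ < η → (bondPercolation (zdGraph 2) half).real {ω : BondConfig (Site 2) | ¬ ∀ a a' : Site 2 × Fin 4, ((E.IsStartCorner a ∧ (shiftData E w).IsStartCorner a') ∨ (a = a' ∧ medialPoint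 E.δ (cSrc a) ∈ ball (meshPoint E.δ v) ρ ∧ medialPoint E.δ (cTgt a) ∉ ball (meshPoint E.δ v) ρ)) → ∀ n : ℕ, (∀ i < n, medialPoint E.δ (cTgt (cornerOrbit (E.bcBondConfig ω) a i)) ∉ ball (meshPoint E.δ v) ρ ∧ E.IsInnerFace (cFace (cornerOrbit (E.bcBondConfig ω) a (i + 1)))) → medialPoint E.δ (cTgt (cornerOrbit (E.bcBondConfig ω) a n)) ∈ ball (meshPoint E.δ v) ρ → ∃ n' : ℕ, (∀ i < n', medialPoint E.δ (cTgt (cornerOrbit ((shiftData E w).bcBondConfig ω) a' i)) ∉ ball (meshPoint E.δ v) ρ ∧ (shiftData E w).IsInnerFace (cFace (cornerOrbit ((shiftData E w).bcBondConfig ω) a' (i + 1)))) ∧ cornerOrbit ((shiftData E w).bcBondConfig ω) a' n' = cornerOrbit (E.bcBondConfig ω) a n ∧ ∑ i ∈ Finset.range n', turnOf ((shiftData E w).bcBondConfig ω) (cornerOrbit ((shiftData E w).bcBondConfig ω) a' i) = ∑ i ∈ Finset.range n, turnOf (E.bcBondConfig ω) (cornerOrbit (E.bcBondConfig ω) a i)}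 ≤ ε) → ∀ (D : DobrushinDomain) (Λ : ℝ → DiscreteDobrushin), (∀ δ, (Λ δ).Ω = D.carrier) → (∀ δ, (Λ δ).δ = δ) → (∀ᶠ δ in nhdsWithin (0:ℝ) (Set.Ioi 0), (Λ δ).IsZdAdmissible) → ∀ K : Set ℂ, IsCompact K → K ⊆ D.carrier → ∀ ρ > (0:ℝ), cthickening (2 * ρ) K ⊆ D.carrier → ∀ ε > (0:ℝ), ∃ η > (0:ℝ), ∀ᶠ δ in nhdsWithin (0:ℝ) (Set.Ioi 0), ∀ v f w : Site 2, IsCorner v f → meshPoint δ v ∈ K → ‖meshPoint δ w‖ < η → (bondPercolation (zdGraph 2) half).real {ω : BondConfig (Site 2) | ¬ ∀ a a' : Site 2 × Fin 4, (((Λ δ).IsStartCorner a ∧ (shiftData (Λ δ) w).IsStartCorner a') ∨ (a = a' ∧ medialPoint δ (cSrc a) ∈ ball (meshPoint δ v) ρ ∧ medialPoint δ (cTgt a) ∉ ball (meshPoint δ v) ρ)) → ∀ n : ℕ, (∀ i < n, medialPoint δ (cTgt (cornerOrbit ((Λ δ).bcBondConfig ω) a i)) ∉ ball (meshPoint δ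 v) ρ ∧ (Λ δ).IsInnerFace (cFace (cornerOrbit ((Λ δ).bcBondConfig ω) a (i + 1)))) → medialPoint δ (cTgt (cornerOrbit ((Λ δ).bcBondConfig ω) a n)) ∈ ball (meshPoint δ v) ρ → ∃ n' : ℕ, (∀ i < n', medialPoint δ (cTgt (cornerOrbit ((shiftData (Λ δ) w).bcBondConfig ω) a' i)) ∉ ball (meshPoint δ v) ρ ∧ (shiftData (Λ δ) w).IsInnerFace (cFace (cornerOrbit ((shiftData (Λ δ) w).bcBondConfig ω) a' (i + 1)))) ∧ cornerOrbit ((shiftData (Λ δ) w).bcBondConfig ω) a' n' = cornerOrbit ((Λ δ).bcBondConfig ω) a n ∧ ∑ i ∈ Finset.range n', turnOf ((shiftData (Λ δ) w).bcBondConfig ω) (cornerOrbit ((shiftData (Λ δ) w).bcBondConfig ω) a' i) = ∑ i ∈ Finset.range n, turnOf ((Λ δ).bcBondConfig ω) (cornerOrbit ((Λ δ).bcBondConfig ω) a i)} ≤ ε := by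
  intro hU D Λ hΩ hδ hadm K hK hKD ρ hρ hρK ε hε
  obtain ⟨η, hη, δ₀, hδ₀, hE⟩ := hU D K hK hKD ρ hρ hρK ε hε
  refine ⟨η, hη, ?_⟩
  have hsmall : ∀ᶠ δ in 𝓝[>] (0:ℝ), δ < δ₀ :=
    (eventually_lt_nhds hδ₀).filter_mono nhdsWithin_le_nhds
  filter_upwards [hadm, hsmall] with δ hadmδ hδs
  intro v f w _ hvK hw
  have key := hE (Λ δ) (hΩ δ) hadmδ (by rw [hδ]; exact hδs) v w (by rw [hδ]; exact hvK)
    (by rw [hδ]; exact hw)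
  simpa only [hδ] using key

end

end Summit.CriticalPhenomena.CardyFormulaZ2.Cruxes.EdgePrecompact.QkzStripBoundaryArm
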